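import Summits.Langlands.Langlands.Theorems.IrreducibilityBySelfDualityReciprocityUpToIrreducibilityRankOneAboveRamified
import Summits.Langlands.Langlands.Theorems.IrreducibilityBySelfDualityReciprocityUpToIrreducibilityCanonicalRec
import Summits.Langlands.Langlands.Theorems.IrreducibilityBySelfDualityReciprocityUpToIrreducibilityArtinSectorAboveClause
import HarnessLib

/-!
# Line `Sketch` for the crux `ReciprocityUpToIrreducibility` (item stmt-Langlands-14328), continuation c8:
# rank one on the WHOLE finite-order / Artin sector, relative to the Weil–Deligne normalisation above `ℓ`

Support file (closes nothing; `--supports stmt-Langlands-14328`; registered stub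
`stub_glOne_reciprocity_of_isCanonical_of_aboveClause` of the checked skeleton `Lines/Sketch.lean` §1o, lead assembly of
waves N9/N10).

c7 (`…RankOneAllPlaces`, `…ArtinLocalGlobal`) and c8 (`…CanonicalRec`) give both directions of the summit in rank one for
every canonically normalised `Rec`, modulo `FontaineDatumExists` and Neukirch VI (5.6)
(`artinCharacter_localGlobalCompatible`), on the sector "`θ` / `ρ` UNRAMIFIED ABOVE `ℓ`" — the residue B1 of the line.
This file removes the restriction.  Since D1 (2026-08-17 01:52Z: the period ring of the pinned datum IS `B_dR(K_v)`),
open-kernel representations are de Rham above `ℓ` for THE datum UNCONDITIONALLY (`isDeRhamFramed_toLocal_of_isOpen_ker`,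
`isGeometricFramed_of_isOpen_ker'`, file `…ArtinSectorAboveClause`), so the only thing the pinned datum does not yet
decide on the Artin sector is the NORMALISATION of the Weil–Deligne representations it attaches (D2, `WD ∘ D_pst`).  It is
taken as the explicit hypothesis `hWD` at the places above `ℓ`: every WD representation attached to `σ|_{Γ_{K_v}}` (`σ` of
open kernel) is `≅ (σ|_{W_{K_v}}, N = 0)` — Fontaine Exp. VIII §1.3, §2.3.7 for the genuine datum (potentially unramified ⇒
potentially crystalline of weight `0`, `WD(D_pst σ) ≅ (σ|_{W}, 0)`), the recommended Weil–Deligne clause of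
`IsFontaineDatum`.  Under it (and the N9-D twin `stub_rankOne_localGlobal_above_iff_artinCompatible` of c7's ramified-place
iff, now at `v ∣ ℓ`): `Corresponds` at ALL places for every finite-order `θ` given Artin compatibility at its ramified
places (`rankOne_corresponds_of_artinCompatible_of_aboveClause`), hence (A)₁ at every `π_θ` and (B)₁ at every open-kernel
`ρ` for every `Rec` modulo (CFT) (`…_of_artinCompatible_of_aboveClause`), and for every CANONICAL `Rec` modulo
{`FontaineDatumExists`, `artinCharacter_localGlobalCompatible`, `hWD`} only (`stub_glOne_reciprocity_of_isCanonical_of_aboveClause`):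
the whole of `GlobalLanglandsCorrespondenceGLn 1` on the finite-order / Artin sector.  No definitions; std axioms.
-/

noncomputable section

set_option linter.dupNamespace false -- project-wide option (lakefile weak.linter.dupNamespace); `Summit.Langlands.Langlands` is the mandated namespace

open scoped MatrixGroups Matrix NumberField Classical Polynomial
open Filter IsDedekindDomain Field Polynomial
open Literature.NumberTheory.Automorphic Literature.NumberTheory.GaloisRepresentations
open Literature.NumberTheory.PAdicHodge
open Summit.Langlands
open Summit.Langlands.Langlands.Theorems.IrreducibleOffSector

namespace Summit.Langlands.Langlands.Theorems.ReciprocityUpToIrreducibility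

variable {K : Type} [Field K] [NumberField K] {ℓ : ℕ} [Fact ℓ.Prime]

/-! ## 1. Rank one on the whole finite-order sector -/

/-- **Rank one, every `Rec`: `Corresponds` at ALL places for a finite-order `θ` (ramified above `ℓ` allowed), given
Artin compatibility at the ramified places and the Weil–Deligne normalisation of the pinned datum on `ρ` at the ramified
places above `ℓ`.**  Satake–Frobenius matching at the unramified places of `θ`; local–global compatibility there for
every `Rec` (c4, `rankOne_localGlobalCompatibleAt_of_satakeFrobCompatibleAt`, `FontaineDatumExists` at `v ∣ ℓ`); at a
ramified place `v ∤ ℓ` c7's `rankOne_localGlobalCompatibleAt_away_of_artinCompatible`; at a ramified place `v ∣ ℓ` the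
N9-D iff `stub_rankOne_localGlobal_above_iff_artinCompatible` (the attached WD representation exists unconditionally:
`exists_isWeilDeligneOf_toLocal_of_isOpen_ker`, D1). [cite: BuzzardGeeLMS2014, Conj. 3.2.1–3.2.2 (n = 1)]
[cite: TateCorvallis1979, (4.2.1)] [cite: FontaineAsterisque223VIII, §2.3.7] -/
theorem rankOne_corresponds_of_artinCompatible_of_aboveClause
    (hF : FontaineDatumExists) {hcpt : isCompact_glFiniteIntegralLevel 1 K}
    (Rec : ReciprocityData K) (ι : PadicAlgCl ℓ ≃+* ℂ)
    {π : AutomorphicRepData (AutomorphyDatum.gl 1 K hcpt)} {θ : HeckeCharacter K}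
    (hW : π.W = Submodule.span ℂ {fun g : (AdelicGroupData.gl 1 K).Adelic => (detTwist 1 θ g : ℂ)})
    (hW' : π.W' = ⊥) (ρ : FramedGaloisRep K (PadicAlgCl ℓ) 1)
    (hker : IsOpen (ρ.toMonoidHom.ker : Set (absoluteGaloisGroup K)))
    (hρ : ∀ v : HeightOneSpectrum (𝓞 K), θ.IsUnramifiedAt v →
      ρ.IsUnramifiedAt v ∧ ρ.HasFrobCharpolyAt v (X - C (ι.symm (θ.valueAtUniformizer v)⁻¹)))
    (hWD : ∀ (v : HeightOneSpectrum (𝓞 K)) (hv : ((ℓ : ℕ) : 𝓞 K) ∈ v.asIdeal), ¬ θ.IsUnramifiedAt v →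
      ∀ r, (fontainePstAdicCompletion v ℓ hv).IsWeilDeligneOf (ρ.toLocal v) r →
        r.IsEquivalent (WeilDeligneRep.ofRep ((ρ.toLocal v).weilRestrict (v.adicCompletion K))
          (isContinuousRep_weilRestrict_toLocal_of_isOpen_ker ρ hker v)))
    (hcomp : ∀ v : HeightOneSpectrum (𝓞 K), ¬ θ.IsUnramifiedAt v →
      ∀ w : WeilGroup (v.adicCompletion K),
        (ι : PadicAlgCl ℓ →+* ℂ) ((((ρ.toLocal v).toWeilGroupHom w : GL (Fin 1) (PadicAlgCl ℓ)) :
            Matrix (Fin 1) (Fin 1) (PadicAlgCl ℓ)).trace) =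
          ((θ.localComponent v ((Rec.llc v).artin.artin w) : ℂˣ) : ℂ)) :
    Corresponds Rec ι π ρ := by
  have hsat : ∀ v, θ.IsUnramifiedAt v → SatakeFrobCompatibleAt ι π ρ v := fun v hv =>
    satakeFrobCompatibleAt_model_of_hasFrobCharpolyAt ι hW hW' ρ hv (hρ v hv).1 (hρ v hv).2
  have hcof : ∀ᶠ v : HeightOneSpectrum (𝓞 K) in cofinite, θ.IsUnramifiedAt v :=
    HeckeCharacter.isUnramifiedAt_cofinite_holds θ
  refine ⟨hcof.mono hsat, fun v => ?_⟩
  by_cases hv : θ.IsUnramifiedAt v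
  · exact rankOne_localGlobalCompatibleAt_of_satakeFrobCompatibleAt hF Rec ι π θ
      (smul_char_of_detTwist_model hW) ρ hv (hsat v hv)
  · by_cases hℓ : ((ℓ : ℕ) : 𝓞 K) ∈ v.asIdeal
    · exact (stub_rankOne_localGlobal_above_iff_artinCompatible K ℓ hcpt Rec ι π θ
        (smul_char_of_detTwist_model hW) ρ v hℓ (isContinuousRep_weilRestrict_toLocal_of_isOpen_ker ρ hker v)
        (exists_isWeilDeligneOf_toLocal_of_isOpen_ker ρ hker v hℓ) (hWD v hℓ hv)).mpr (hcomp v hv)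
    · exact rankOne_localGlobalCompatibleAt_away_of_artinCompatible Rec ι π θ
        (smul_char_of_detTwist_model hW) ρ hℓ
        (isContinuousRep_weilRestrict_toLocal_of_isOpen_ker ρ hker v) (hcomp v hv)

/-- **(A) in rank one at `π_θ` for EVERY finite-order `θ` (no condition above `ℓ`), every `Rec`, modulo (CFT_θ) and the
Weil–Deligne normalisation of the pinned datum on open-kernel representations above `ℓ`** (under `FontaineDatumExists`).
Generalises c7's `automorphicToGalois_glOne_of_artinCompatible` (which needed `θ` unramified above `ℓ`): the avatar
`ρ = ι⁻¹(ψ_θ)⁻¹` is pinned-geometric unconditionally (`isGeometricFramed_of_isOpen_ker'`); `Corresponds` by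
`rankOne_corresponds_of_artinCompatible_of_aboveClause`; uniqueness up to conjugacy by Chebotarev.
[cite: BuzzardGeeLMS2014, Conj. 3.2.1–3.2.2 (n = 1)] [cite: CasselsFrohlichANT1967, Ch. VII §5.1 Main Theorem]
[cite: FontaineAsterisque223VIII, §1.3 and §2.3.7] -/
theorem automorphicToGalois_glOne_of_artinCompatible_of_aboveClause
    (hF : FontaineDatumExists) {hcpt : isCompact_glFiniteIntegralLevel 1 K}
    (Rec : ReciprocityData K) (ι : PadicAlgCl ℓ ≃+* ℂ)
    {π : AutomorphicRepData (AutomorphyDatum.gl 1 K hcpt)} {θ : HeckeCharacter K}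
    (hW : π.W = Submodule.span ℂ {fun g : (AdelicGroupData.gl 1 K).Adelic => (detTwist 1 θ g : ℂ)})
    (hW' : π.W' = ⊥) (hfin : θ.IsFiniteOrder)
    (hWD : ∀ (v : HeightOneSpectrum (𝓞 K)) (hv : ((ℓ : ℕ) : 𝓞 K) ∈ v.asIdeal)
      (σ : FramedGaloisRep K (PadicAlgCl ℓ) 1) (hσ : IsOpen (σ.toMonoidHom.ker : Set (absoluteGaloisGroup K))),
      ∀ r, (fontainePstAdicCompletion v ℓ hv).IsWeilDeligneOf (σ.toLocal v) r →
        r.IsEquivalent (WeilDeligneRep.ofRep ((σ.toLocal v).weilRestrict (v.adicCompletion K))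
          (isContinuousRep_weilRestrict_toLocal_of_isOpen_ker σ hσ v)))
    (hCFT : ∀ ρ : FramedGaloisRep K (PadicAlgCl ℓ) 1,
      IsOpen (ρ.toMonoidHom.ker : Set (absoluteGaloisGroup K)) →
      (∀ v : HeightOneSpectrum (𝓞 K), θ.IsUnramifiedAt v →
        ρ.IsUnramifiedAt v ∧ ρ.HasFrobCharpolyAt v (X - C (ι.symm (θ.valueAtUniformizer v)⁻¹))) →
      ∀ v : HeightOneSpectrum (𝓞 K), ¬ θ.IsUnramifiedAt v →
        ∀ w : WeilGroup (v.adicCompletion K),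
          (ι : PadicAlgCl ℓ →+* ℂ) ((((ρ.toLocal v).toWeilGroupHom w : GL (Fin 1) (PadicAlgCl ℓ)) :
              Matrix (Fin 1) (Fin 1) (PadicAlgCl ℓ)).trace) =
            ((θ.localComponent v ((Rec.llc v).artin.artin w) : ℂˣ) : ℂ)) :
    ∃ ρ : FramedGaloisRep K (PadicAlgCl ℓ) 1,
      ρ.toGaloisRep.IsIrreducible ∧ IsGeometricFramed Rec ρ ∧ Corresponds Rec ι π ρ ∧
        ∀ ρ' : FramedGaloisRep K (PadicAlgCl ℓ) 1, Corresponds Rec ι π ρ' → IsConjugate ρ ρ' := by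
  obtain ⟨ψ, hram, hfrob⟩ := θ.exists_framedArtinRep_of_isFiniteOrder hfin
  have hker : IsOpen ((ψ.lAdicAvatar ι).toMonoidHom.ker : Set (absoluteGaloisGroup K)) :=
    isOpen_ker_lAdicAvatar ψ ι
  have hρ : ∀ v : HeightOneSpectrum (𝓞 K), θ.IsUnramifiedAt v →
      (ψ.lAdicAvatar ι).IsUnramifiedAt v ∧
        (ψ.lAdicAvatar ι).HasFrobCharpolyAt v (X - C (ι.symm (θ.valueAtUniformizer v)⁻¹)) :=
    fun v hv => ⟨(ψ.isUnramifiedAt_lAdicAvatar_iff ι v).mpr ((hram v).mpr hv),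
      ψ.hasFrobCharpolyAt_lAdicAvatar ι (hfrob v hv)⟩
  have hcorr : Corresponds Rec ι π (ψ.lAdicAvatar ι) :=
    rankOne_corresponds_of_artinCompatible_of_aboveClause hF Rec ι hW hW' (ψ.lAdicAvatar ι) hker hρ
      (fun v hv _ => hWD v hv (ψ.lAdicAvatar ι) hker) (hCFT (ψ.lAdicAvatar ι) hker hρ)
  exact ⟨ψ.lAdicAvatar ι, isIrreducible_of_rank_one _, isGeometricFramed_of_isOpen_ker' Rec _ hker, hcorr,
    fun ρ' h' => isConjugate_of_satakeFrobCompatibleAt π ι (isIrreducible_of_rank_one _) hcorr.1 h'.1⟩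

/-- **(B) in rank one at EVERY open-kernel `ρ` (no condition above `ℓ`, no "unramified a.e." hypothesis), every `Rec`,
modulo (CFT_ρ) and the Weil–Deligne normalisation of the pinned datum on `ρ` above `ℓ`** (under `FontaineDatumExists`).
Generalises c7's `galoisToAutomorphic_glOne_of_artinCompatible`. [cite: FontaineMazurGeometric1995, Conj. 1 (n = 1)]
[cite: CasselsFrohlichANT1967, Ch. VII §5.1 Main Theorem] [cite: FontaineAsterisque223VIII, §2.3.7] -/
theorem galoisToAutomorphic_glOne_of_artinCompatible_of_aboveClause
    (hF : FontaineDatumExists) (hcpt : isCompact_glFiniteIntegralLevel 1 K)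
    (Rec : ReciprocityData K) (ι : PadicAlgCl ℓ ≃+* ℂ) (ρ : FramedGaloisRep K (PadicAlgCl ℓ) 1)
    (hker : IsOpen (ρ.toMonoidHom.ker : Set (absoluteGaloisGroup K)))
    (hWD : ∀ (v : HeightOneSpectrum (𝓞 K)) (hv : ((ℓ : ℕ) : 𝓞 K) ∈ v.asIdeal), ¬ ρ.IsUnramifiedAt v →
      ∀ r, (fontainePstAdicCompletion v ℓ hv).IsWeilDeligneOf (ρ.toLocal v) r →
        r.IsEquivalent (WeilDeligneRep.ofRep ((ρ.toLocal v).weilRestrict (v.adicCompletion K))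
          (isContinuousRep_weilRestrict_toLocal_of_isOpen_ker ρ hker v)))
    (hCFT : ∀ χ : HeckeCharacter K, χ.IsFiniteOrder →
      (∀ v : HeightOneSpectrum (𝓞 K), ρ.IsUnramifiedAt v →
        χ.IsUnramifiedAt v ∧ ρ.HasFrobCharpolyAt v (X - C (ι.symm (χ.valueAtUniformizer v)⁻¹))) →
      ∀ v : HeightOneSpectrum (𝓞 K), ¬ ρ.IsUnramifiedAt v →
        ∀ w : WeilGroup (v.adicCompletion K),
          (ι : PadicAlgCl ℓ →+* ℂ) ((((ρ.toLocal v).toWeilGroupHom w : GL (Fin 1) (PadicAlgCl ℓ)) :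
              Matrix (Fin 1) (Fin 1) (PadicAlgCl ℓ)).trace) =
            ((χ.localComponent v ((Rec.llc v).artin.artin w) : ℂˣ) : ℂ)) :
    ∃ π : CuspidalAutomorphicRepData 1 K hcpt, π.1.IsLAlgebraic ∧ Corresponds Rec ι π.1 ρ := by
  obtain ⟨χ, -, hfin, hχ⟩ := ρ.exists_heckeCharacter_of_isOpen_ker hker ι
  obtain ⟨π, hW, hW', hL⟩ := stub_rankOne_cuspidalModel_of_isFiniteOrder K hcpt χ hfin
  have hsat : ∀ v, ρ.IsUnramifiedAt v → SatakeFrobCompatibleAt ι π.1 ρ v := fun v hv =>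
    satakeFrobCompatibleAt_model_of_hasFrobCharpolyAt ι hW hW' ρ (hχ v hv).1 hv (hχ v hv).2
  refine ⟨π, hL, (ρ.eventually_isUnramifiedAt_of_isOpen_ker hker).mono hsat, fun v => ?_⟩
  by_cases hv : ρ.IsUnramifiedAt v
  · exact rankOne_localGlobalCompatibleAt_of_satakeFrobCompatibleAt hF Rec ι π.1 χ
      (smul_char_of_detTwist_model hW) ρ (hχ v hv).1 (hsat v hv)
  · by_cases hℓ : ((ℓ : ℕ) : 𝓞 K) ∈ v.asIdeal
    · exact (stub_rankOne_localGlobal_above_iff_artinCompatible K ℓ hcpt Rec ι π.1 χ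
        (smul_char_of_detTwist_model hW) ρ v hℓ (isContinuousRep_weilRestrict_toLocal_of_isOpen_ker ρ hker v)
        (exists_isWeilDeligneOf_toLocal_of_isOpen_ker ρ hker v hℓ) (hWD v hℓ hv)).mpr (hCFT χ hfin hχ v hv)
    · exact rankOne_localGlobalCompatibleAt_away_of_artinCompatible Rec ι π.1 χ
        (smul_char_of_detTwist_model hW) ρ hℓ
        (isContinuousRep_weilRestrict_toLocal_of_isOpen_ker ρ hker v) (hCFT χ hfin hχ v hv)

/-- **Registered stub (c8, lead assembly of waves N9/N10): `GlobalLanglandsCorrespondenceGLn 1` on the WHOLE finite-order /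
Artin sector for every CANONICALLY NORMALISED `Rec`, modulo `FontaineDatumExists`, Neukirch VI (5.6)
(`artinCharacter_localGlobalCompatible`) and the Weil–Deligne normalisation `hWD` of the pinned datum on open-kernel
rank-one representations above `ℓ` (D2; de Rham-ness is unconditional since D1).**  (A) at `π_θ` for EVERY finite-order
`θ`: an irreducible pinned-geometric `ρ` with `Corresponds Rec ι π_θ ρ` at every finite place, unique up to conjugacy;
(B) at EVERY open-kernel `ρ : Γ_K → GL₁(ℚ̄_ℓ)`: a cuspidal L-algebraic `π` with `Corresponds Rec ι π ρ`.  Compared with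
`stub_glOne_reciprocity_of_isCanonical` the hypotheses "unramified above `ℓ`" and "unramified a.e." are gone; the price is
`hWD`, a theorem for Fontaine's `WD ∘ D_pst` (the recommended Weil–Deligne clause of `IsFontaineDatum`).
[cite: BuzzardGeeLMS2014, Conj. 3.2.1–3.2.2 (n = 1)] [cite: NeukirchANT1999, Ch. VI Prop. (5.6)]
[cite: FontaineMazurGeometric1995, Conj. 1 (n = 1)] [cite: FontaineAsterisque223VIII, §1.3 and §2.3.7] -/
theorem stub_glOne_reciprocity_of_isCanonical_of_aboveClause :
    FontaineDatumExists → artinCharacter_localGlobalCompatible →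
    ∀ (K : Type) [Field K] [NumberField K] (ℓ : ℕ) [Fact ℓ.Prime]
      (hcpt : isCompact_glFiniteIntegralLevel 1 K) (Rec : ReciprocityData K),
      (∀ v : HeightOneSpectrum (𝓞 K), (Rec.llc v).artin.IsCanonical) →
      (∀ (v : HeightOneSpectrum (𝓞 K)) (hv : ((ℓ : ℕ) : 𝓞 K) ∈ v.asIdeal)
        (σ : FramedGaloisRep K (PadicAlgCl ℓ) 1)
        (hσ : IsOpen (σ.toMonoidHom.ker : Set (Field.absoluteGaloisGroup K))),
        ∀ r, (Literature.NumberTheory.PAdicHodge.fontainePstAdicCompletion v ℓ hv).IsWeilDeligneOf (σ.toLocal v) r →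
          r.IsEquivalent (WeilDeligneRep.ofRep ((σ.toLocal v).weilRestrict (v.adicCompletion K))
            (isContinuousRep_weilRestrict_toLocal_of_isOpen_ker σ hσ v))) →
      ∀ ι : PadicAlgCl ℓ ≃+* ℂ,
      (∀ (π : AutomorphicRepData (AutomorphyDatum.gl 1 K hcpt)) (θ : HeckeCharacter K),
        π.W = Submodule.span ℂ {fun g : (AdelicGroupData.gl 1 K).Adelic => (detTwist 1 θ g : ℂ)} →
        π.W' = ⊥ → θ.IsFiniteOrder →
        ∃ ρ : FramedGaloisRep K (PadicAlgCl ℓ) 1,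
          ρ.toGaloisRep.IsIrreducible ∧ IsGeometricFramed Rec ρ ∧ Corresponds Rec ι π ρ ∧
            ∀ ρ' : FramedGaloisRep K (PadicAlgCl ℓ) 1, Corresponds Rec ι π ρ' → IsConjugate ρ ρ') ∧
      (∀ ρ : FramedGaloisRep K (PadicAlgCl ℓ) 1,
        IsOpen (ρ.toMonoidHom.ker : Set (Field.absoluteGaloisGroup K)) →
        ∃ π : CuspidalAutomorphicRepData 1 K hcpt, π.1.IsLAlgebraic ∧ Corresponds Rec ι π.1 ρ) := by
  intro hF hLG K _ _ ℓ _ hcpt Rec hRec hWD ι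
  refine ⟨fun π θ hW hW' hfin => ?_, fun ρ hker => ?_⟩
  · -- (A): the avatar of the Artin character of `θ`, Artin-compatible at EVERY place for canonical `Rec`
    obtain ⟨ψ, hram, hfrob⟩ := θ.exists_framedArtinRep_of_isFiniteOrder hfin
    have hker : IsOpen ((ψ.lAdicAvatar ι).toMonoidHom.ker : Set (absoluteGaloisGroup K)) :=
      isOpen_ker_lAdicAvatar ψ ι
    have hρ : ∀ v : HeightOneSpectrum (𝓞 K), θ.IsUnramifiedAt v →
        (ψ.lAdicAvatar ι).IsUnramifiedAt v ∧
          (ψ.lAdicAvatar ι).HasFrobCharpolyAt v (X - C (ι.symm (θ.valueAtUniformizer v)⁻¹)) :=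
      fun v hv => ⟨(ψ.isUnramifiedAt_lAdicAvatar_iff ι v).mpr ((hram v).mpr hv),
        ψ.hasFrobCharpolyAt_lAdicAvatar ι (hfrob v hv)⟩
    have hcorr : Corresponds Rec ι π (ψ.lAdicAvatar ι) :=
      rankOne_corresponds_of_artinCompatible_of_aboveClause hF Rec ι hW hW' (ψ.lAdicAvatar ι) hker hρ
        (fun v hv _ => hWD v hv (ψ.lAdicAvatar ι) hker) fun v _ w =>
          artinCompatible_lAdicAvatar hLG hfin hram hfrob ι Rec (isLocalArtinMap_of_isCanonical (hRec v)) w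
    exact ⟨ψ.lAdicAvatar ι, isIrreducible_of_rank_one _, isGeometricFramed_of_isOpen_ker' Rec _ hker, hcorr,
      fun ρ' h' => isConjugate_of_satakeFrobCompatibleAt π ι (isIrreducible_of_rank_one _) hcorr.1 h'.1⟩
  · -- (B): `ρ` is the avatar of the Artin character of its Hecke character; compatibility as in (A)
    have hae : ∀ᶠ v : HeightOneSpectrum (𝓞 K) in cofinite, ρ.IsUnramifiedAt v :=
      ρ.eventually_isUnramifiedAt_of_isOpen_ker hker
    refine galoisToAutomorphic_glOne_of_artinCompatible_of_aboveClause hF hcpt Rec ι ρ hker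
      (fun v hv _ => hWD v hv ρ hker) ?_
    intro χ hfinχ hχ v _ w
    obtain ⟨ψ, hram, hfrob⟩ := χ.exists_framedArtinRep_of_isFiniteOrder hfinχ
    have hρψ : ρ = ψ.lAdicAvatar ι := eq_lAdicAvatar_of_hasFrobCharpolyAt ι ρ hae hχ hram hfrob
    have key := artinCompatible_lAdicAvatar hLG hfinχ hram hfrob ι Rec
      (isLocalArtinMap_of_isCanonical (hRec v)) w
    rw [← hρψ] at key
    exact key

end Summit.Langlands.Langlands.Theorems.ReciprocityUpToIrreducibility

end
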